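import Summits.Ventures.Crystal3D.Theorems.StickyWulffConstantGenericWallFloorRayTerraceA
import HarnessLib

/-!
# The terrace-steered steep family, part 3: ray b, and the `hdirs` DISCHARGE — every held direction rises by `≥ 1/2`
# against the cap-centre vertical (crux `GenericWallFloor`, stmt-Ventures-19480, line `WallLedgerG`)

HONEST FRAMING. Venture `Summits/Ventures/Crystal3D` (cell `crystal3d-full`), helper `--supports` the crux
`GenericWallFloor` (stmt-Ventures-19480) of `route-Ventures-StickyWulffConstant`, REGISTERED line `WallLedgerG`, open
stub `stub_twoSlabAdhesion`.  Rung credit only; F-C1 not moved; NOT the stub; census-free, standard axioms.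

This closes the lane-G question «is the W1 hypothesis `hdirs` dischargeable?» (cf-p1 (xxxix), ROUTE §86(85)/(86b);
19480-p2 g7's floor-leak obstruction 2026-08-28T15:12Z) for the TERRACE-STEERED STEEP FAMILY: base frame `A`, start slot
`u = slotSite 8` (cubic `(0,1,1)/√2`), steering `z = A ẑ` with `cubicCoords ẑ = (34,32,33)/√3269` (the terrace normal
`(1,1,1)/√3` tilted by `1.3°`; on the nine zero-cost `Σ3` riser minimizers of RISER-LEDGER-g8 its walks coincide with the
menu of record, certified count `4.000` balls/ul/interface — calc/g8/famcheck.py of the seat folder, evidence on the item).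
* `rayB_level0/1`, `rayB_circle_*` — ray b (first push through cubic `(−1,1,1)/√3`): levels `0,1` explicit, then the
  invariant circle about the cubic axis `(4,2,5)` (`c² + 45 s² = 1`, rotation `(c,s) ↦ (−2c/3 + 5s, −2s/3 − c/9)`).
* **`forcedTop_dir_cubic_terrace`** — EVERY level of EITHER forced ray has direction numerator `X` with `X·(1,1,4) ≥ 3`;
  **`forcedTop_dir_inner_terrace`** — `⟪d, A w₀⟫ ≥ 1/2` for the lattice unit vector `w₀`, `cubicCoords w₀ = (1,1,4)/(3√2)`
  (the inward wall normal pulled back to the grain at the exact cap centre); the start slot gives `5/6`.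
* **`stack_dirs_terrace`** — the STACK FORM `entries_forced` consumes: for every sound well-formed `z`-stack over
  `⟨A, slotSite 8, 0⟩`, every entry has `⟪e.frame e.dir, A w₀⟫ ≥ 1/2`;  **`stack_dirs_terrace_of_near`** — for ANY
  vector `w` (the ledger's inward vertical `∓e₃`): `⟪e.frame e.dir, w⟫ ≥ 1/2 − ‖A.symm w − w₀‖` — the W1 hypothesis with
  an orientation-dependent `δ > 0` on the whole residual cap (`δ ≥ 0.22` at `16°`); `stack_dir_norm_terrace`.
* `exists_terrace_steering` (unit `ẑ`, steepness `⟪A u, A ẑ⟫ ≥ √2/2`, the `hZ` datum with `t = 1/√3269`),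
  `exists_cap_centre_vertical`, `exists_of_cubicCoords`.
Numerics of record (exact, calc/lattice.py): infimum of the cosine over all reachable directions `= 1/2` (attained at
ray-a levels 0 and 1); on the circles `9/10 − 1/10 = 0.8` (ray a) and `13/15 − √(67/4050) = 0.738` (ray b); the previous
tie-break (ε = 1/97) leaves the small circle at level 20 and has infimum `0.3151`.  The mirror slot `slotSite 4`
(cubic `(1,0,1)`) with steering `(32,34,33)` is the same statement for the frame `A ∘ S`, `S` the swap of cubic axes 0,1.
WHAT THIS IS NOT: not the W1 ledger itself (19480-p2), not the stub, no packing statement; F-C1 not moved.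
-/

noncomputable section

namespace Summit.Ventures.Crystal3D.Theorems

open Summit.Ventures.Crystal3D Finset Matrix
open scoped InnerProductSpace

/-! ### Ray b (through the cubic normal `(−1,1,1)`): transient levels 0–1 and the invariant circle about `(4,2,5)` -/

/-- Ray b, level `0`: direction numerator `('-1/3', '1/3', '4/3')`, next push normal `('1/3', '-1/3', '5/3')`. -/
theorem rayB_level0 (A : EuclideanSpace ℝ (Fin 3) ≃ₗᵢ[ℝ] EuclideanSpace ℝ (Fin 3))
    {n z : EuclideanSpace ℝ (Fin 3)} {t : ℝ} (hn : ‖n‖ = 1)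
    (hmenu : ∀ w ∈ fccSlots, ⟪A w, n⟫_ℝ = 0 ∨ ⟪A w, n⟫_ℝ = Real.sqrt (2 / 3) ∨ ⟪A w, n⟫_ℝ = -Real.sqrt (2 / 3))
    (hpos : ⟪A (slotSite 8), n⟫_ℝ = Real.sqrt (2 / 3))
    (hPn : cubicCoords (A.symm n) = (Real.sqrt 3)⁻¹ • (![(-1 : ℝ), 1, 1] : Fin 3 → ℝ))
    (hZ : cubicCoords (A.symm z) = t • (![(34 : ℝ), 32, 33] : Fin 3 → ℝ)) (ht : 0 < t) :
    cubicCoords (A.symm ((forcedTop z ⟨A, slotSite 8, 0⟩ n 0).frame (forcedTop z ⟨A, slotSite 8, 0⟩ n 0).dir)) =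
        (Real.sqrt 2)⁻¹ • (![(-1 : ℝ)/3, 1/3, 4/3] : Fin 3 → ℝ) ∧
      cubicCoords (A.symm (nextNormal (forcedTop z ⟨A, slotSite 8, 0⟩ n 0))) =
        (Real.sqrt 3)⁻¹ • (![(1 : ℝ)/3, -1/3, 5/3] : Fin 3 → ℝ) := by
  have hsel := triple_selection (X := (![(0 : ℝ), 1, 1] : Fin 3 → ℝ)) (P := (![(-1 : ℝ), 1, 1] : Fin 3 → ℝ))
    (Zc := (![(34 : ℝ), 32, 33] : Fin 3 → ℝ)) (Xj := (![(-1 : ℝ), 1, 0] : Fin 3 → ℝ)) (X₂ := (![(-1 : ℝ), 1, 0] : Fin 3 → ℝ)) (X₃ := (![(-1 : ℝ), 0, 1] : Fin 3 → ℝ))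
    (by ext i; fin_cases i <;> norm_num [cross_apply, Matrix.cons_val_zero, Matrix.cons_val_one, Matrix.cons_val_two, Matrix.head_cons, Matrix.tail_cons])
    (by ext i; fin_cases i <;> norm_num [cross_apply, Matrix.cons_val_zero, Matrix.cons_val_one, Matrix.cons_val_two, Matrix.head_cons, Matrix.tail_cons])
    (Or.inr (Or.inl rfl))
    (fun _ => by norm_num [dotProduct, Fin.sum_univ_three, Matrix.cons_val_zero, Matrix.cons_val_one,
      Matrix.cons_val_two, Matrix.head_cons, Matrix.tail_cons])
    (fun h => (h rfl).elim)
    (fun _ => by norm_num [dotProduct, Fin.sum_univ_three, Matrix.cons_val_zero, Matrix.cons_val_one,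
      Matrix.cons_val_two, Matrix.head_cons, Matrix.tail_cons])
  obtain ⟨h1, h2⟩ := forcedTop_zero_cubic A (slotSite_mem 8) hn hmenu hpos hZ ht cubicCoords_slotSite_eight hPn
    hsel.1 hsel.2
  have e1 : ((4 / 3 : ℝ) • (![(-1 : ℝ), 1, 1] : Fin 3 → ℝ) - ![(-1 : ℝ), 1, 0]) = ![(-1 : ℝ)/3, 1/3, 4/3] := by
    ext i; fin_cases i <;> norm_num [Matrix.cons_val_zero, Matrix.cons_val_one, Matrix.cons_val_two, Matrix.head_cons, Matrix.tail_cons]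
  have e2 : ((5 / 3 : ℝ) • (![(-1 : ℝ), 1, 1] : Fin 3 → ℝ) - (2 : ℝ) • ![(-1 : ℝ), 1, 0]) = ![(1 : ℝ)/3, -1/3, 5/3] := by
    ext i; fin_cases i <;> norm_num [Matrix.cons_val_zero, Matrix.cons_val_one, Matrix.cons_val_two, Matrix.head_cons, Matrix.tail_cons]
  rw [e1] at h1; rw [e2] at h2
  exact ⟨h1, h2⟩

/-- Ray b, level `1`: direction numerator `('4/9', '5/9', '11/9')`, next push normal `('5/9', '13/9', '7/9')`. -/
theorem rayB_level1 (A : EuclideanSpace ℝ (Fin 3) ≃ₗᵢ[ℝ] EuclideanSpace ℝ (Fin 3))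
    {n z : EuclideanSpace ℝ (Fin 3)} {t : ℝ} (hn : ‖n‖ = 1)
    (hmenu : ∀ w ∈ fccSlots, ⟪A w, n⟫_ℝ = 0 ∨ ⟪A w, n⟫_ℝ = Real.sqrt (2 / 3) ∨ ⟪A w, n⟫_ℝ = -Real.sqrt (2 / 3))
    (hpos : ⟪A (slotSite 8), n⟫_ℝ = Real.sqrt (2 / 3))
    (hPn : cubicCoords (A.symm n) = (Real.sqrt 3)⁻¹ • (![(-1 : ℝ), 1, 1] : Fin 3 → ℝ))
    (hZ : cubicCoords (A.symm z) = t • (![(34 : ℝ), 32, 33] : Fin 3 → ℝ)) (ht : 0 < t) :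
    cubicCoords (A.symm ((forcedTop z ⟨A, slotSite 8, 0⟩ n 1).frame (forcedTop z ⟨A, slotSite 8, 0⟩ n 1).dir)) =
        (Real.sqrt 2)⁻¹ • (![(4 : ℝ)/9, 5/9, 11/9] : Fin 3 → ℝ) ∧
      cubicCoords (A.symm (nextNormal (forcedTop z ⟨A, slotSite 8, 0⟩ n 1))) =
        (Real.sqrt 3)⁻¹ • (![(5 : ℝ)/9, 13/9, 7/9] : Fin 3 → ℝ) := by
  have hsel := triple_selection (X := (![(-1 : ℝ)/3, 1/3, 4/3] : Fin 3 → ℝ)) (P := (![(1 : ℝ)/3, -1/3, 5/3] : Fin 3 → ℝ))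
    (Zc := (![(34 : ℝ), 32, 33] : Fin 3 → ℝ)) (Xj := (![(0 : ℝ), -1, 1] : Fin 3 → ℝ)) (X₂ := (![(0 : ℝ), -1, 1] : Fin 3 → ℝ)) (X₃ := (![(1 : ℝ), 0, 1] : Fin 3 → ℝ))
    (by ext i; fin_cases i <;> norm_num [cross_apply, Matrix.cons_val_zero, Matrix.cons_val_one, Matrix.cons_val_two, Matrix.head_cons, Matrix.tail_cons])
    (by ext i; fin_cases i <;> norm_num [cross_apply, Matrix.cons_val_zero, Matrix.cons_val_one, Matrix.cons_val_two, Matrix.head_cons, Matrix.tail_cons])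
    (Or.inr (Or.inl rfl))
    (fun _ => by norm_num [dotProduct, Fin.sum_univ_three, Matrix.cons_val_zero, Matrix.cons_val_one,
      Matrix.cons_val_two, Matrix.head_cons, Matrix.tail_cons])
    (fun h => (h rfl).elim)
    (fun _ => by norm_num [dotProduct, Fin.sum_univ_three, Matrix.cons_val_zero, Matrix.cons_val_one,
      Matrix.cons_val_two, Matrix.head_cons, Matrix.tail_cons])
  obtain ⟨hX, hP⟩ := rayB_level0 A hn hmenu hpos hPn hZ ht
  obtain ⟨h1, h2⟩ := forcedTop_succ_cubic A hn hmenu hZ ht 0 hX hP hsel.1 hsel.2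
  have e1 : ((4 / 3 : ℝ) • (![(1 : ℝ)/3, -1/3, 5/3] : Fin 3 → ℝ) - ![(0 : ℝ), -1, 1]) = ![(4 : ℝ)/9, 5/9, 11/9] := by
    ext i; fin_cases i <;> norm_num [Matrix.cons_val_zero, Matrix.cons_val_one, Matrix.cons_val_two, Matrix.head_cons, Matrix.tail_cons]
  have e2 : ((5 / 3 : ℝ) • (![(1 : ℝ)/3, -1/3, 5/3] : Fin 3 → ℝ) - (2 : ℝ) • ![(0 : ℝ), -1, 1]) = ![(5 : ℝ)/9, 13/9, 7/9] := by
    ext i; fin_cases i <;> norm_num [Matrix.cons_val_zero, Matrix.cons_val_one, Matrix.cons_val_two, Matrix.head_cons, Matrix.tail_cons]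
  rw [e1] at h1; rw [e2] at h2
  exact ⟨h1, h2⟩

/-- Ray b: on the circle the third member of the rising triple is strictly `Z`-lowest. -/
theorem rayB_circle_selection (c s : ℝ) (h : c ^ 2 + 45 * s ^ 2 = 1) (X P : Fin 3 → ℝ)
    (hX : X = (![(4 : ℝ)/5, 2/5, 1] + c • ![(-16 : ℝ)/45, 7/45, 2/9] + s • ![(-1 : ℝ)/3, -8/3, 4/3])) (hP : P = (![(4 : ℝ)/5, 2/5, 1] + c • ![(-11 : ℝ)/45, 47/45, -2/9] + s • ![(-17 : ℝ)/3, -1/3, 14/3])) :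
    ((1 / 2 : ℝ) • (-X - P ⨯₃ X + (2 : ℝ) • P) = X ∨ (1 / 2 : ℝ) • (-X - P ⨯₃ X + (2 : ℝ) • P) = (1 / 2 : ℝ) • (-X + P ⨯₃ X + (2 : ℝ) • P) ∨
      (1 / 2 : ℝ) • (-X - P ⨯₃ X + (2 : ℝ) • P) = (1 / 2 : ℝ) • (-X - P ⨯₃ X + (2 : ℝ) • P)) ∧
    (∀ Y : Fin 3 → ℝ, (Y = X ∨ Y = (1 / 2 : ℝ) • (-X + P ⨯₃ X + (2 : ℝ) • P) ∨
        Y = (1 / 2 : ℝ) • (-X - P ⨯₃ X + (2 : ℝ) • P)) → Y ≠ (1 / 2 : ℝ) • (-X - P ⨯₃ X + (2 : ℝ) • P) →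
      (![(34 : ℝ), 32, 33] : Fin 3 → ℝ) ⬝ᵥ ((1 / 2 : ℝ) • (-X - P ⨯₃ X + (2 : ℝ) • P)) < (![(34 : ℝ), 32, 33] : Fin 3 → ℝ) ⬝ᵥ Y) := by
  have hA : (0 : ℝ) < 45 := by norm_num
  have i0 : 0 < (![(34 : ℝ), 32, 33] : Fin 3 → ℝ) ⬝ᵥ X - (![(34 : ℝ), 32, 33] : Fin 3 → ℝ) ⬝ᵥ ((1 / 2 : ℝ) • (-X - P ⨯₃ X + (2 : ℝ) • P)) := by
    have e : (![(34 : ℝ), 32, 33] : Fin 3 → ℝ) ⬝ᵥ X - (![(34 : ℝ), 32, 33] : Fin 3 → ℝ) ⬝ᵥ ((1 / 2 : ℝ) • (-X - P ⨯₃ X + (2 : ℝ) • P)) =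
        (146/3 : ℝ) + (-160/9 : ℝ) * c + (148/3 : ℝ) * s + (73/6 : ℝ) * (c ^ 2 + 45 * s ^ 2 - 1) := by
      subst hX; subst hP
      simp [dotProduct, Fin.sum_univ_three, cross_apply, Matrix.cons_val_zero, Matrix.cons_val_one, Matrix.cons_val_two,
        Matrix.head_cons, Matrix.tail_cons]
      ring
    rw [e, h, sub_self, mul_zero, add_zero]
    exact lin_pos_on_ellipse hA h (by norm_num) (by norm_num)
  have i1 : 0 < (![(34 : ℝ), 32, 33] : Fin 3 → ℝ) ⬝ᵥ ((1 / 2 : ℝ) • (-X + P ⨯₃ X + (2 : ℝ) • P)) - (![(34 : ℝ), 32, 33] : Fin 3 → ℝ) ⬝ᵥ ((1 / 2 : ℝ) • (-X - P ⨯₃ X + (2 : ℝ) • P)) := by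
    have e : (![(34 : ℝ), 32, 33] : Fin 3 → ℝ) ⬝ᵥ ((1 / 2 : ℝ) • (-X + P ⨯₃ X + (2 : ℝ) • P)) - (![(34 : ℝ), 32, 33] : Fin 3 → ℝ) ⬝ᵥ ((1 / 2 : ℝ) • (-X - P ⨯₃ X + (2 : ℝ) • P)) =
        (73/3 : ℝ) + (-2/3 : ℝ) * c + (158 : ℝ) * s + (73/3 : ℝ) * (c ^ 2 + 45 * s ^ 2 - 1) := by
      subst hX; subst hP
      simp [dotProduct, Fin.sum_univ_three, cross_apply, Matrix.cons_val_zero, Matrix.cons_val_one, Matrix.cons_val_two,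
        Matrix.head_cons, Matrix.tail_cons]
      ring
    rw [e, h, sub_self, mul_zero, add_zero]
    exact lin_pos_on_ellipse hA h (by norm_num) (by norm_num)
  refine ⟨Or.inr (Or.inr rfl), ?_⟩
  rintro Y (rfl | rfl | rfl) hne
  · linarith [i0]
  · linarith [i1]
  · exact (hne rfl).elim

/-- Ray b: one push on the circle is the rotation `(c,s) ↦ (c',s')` of the parameters. -/
theorem rayB_circle_update (c s : ℝ) (h : c ^ 2 + 45 * s ^ 2 = 1) (X P : Fin 3 → ℝ)
    (hX : X = (![(4 : ℝ)/5, 2/5, 1] + c • ![(-16 : ℝ)/45, 7/45, 2/9] + s • ![(-1 : ℝ)/3, -8/3, 4/3])) (hP : P = (![(4 : ℝ)/5, 2/5, 1] + c • ![(-11 : ℝ)/45, 47/45, -2/9] + s • ![(-17 : ℝ)/3, -1/3, 14/3])) :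
    (4 / 3 : ℝ) • P - (1 / 2 : ℝ) • (-X - P ⨯₃ X + (2 : ℝ) • P) = (![(4 : ℝ)/5, 2/5, 1] + (-(2 : ℝ) / 3 * c - (-1 : ℝ) * 5 * s) • ![(-16 : ℝ)/45, 7/45, 2/9] + (-(2 : ℝ) / 3 * s + (-1 : ℝ) * (1/9 : ℝ) * c) • ![(-1 : ℝ)/3, -8/3, 4/3]) ∧
    (5 / 3 : ℝ) • P - (2 : ℝ) • ((1 / 2 : ℝ) • (-X - P ⨯₃ X + (2 : ℝ) • P)) = (![(4 : ℝ)/5, 2/5, 1] + (-(2 : ℝ) / 3 * c - (-1 : ℝ) * 5 * s) • ![(-11 : ℝ)/45, 47/45, -2/9] + (-(2 : ℝ) / 3 * s + (-1 : ℝ) * (1/9 : ℝ) * c) • ![(-17 : ℝ)/3, -1/3, 14/3]) ∧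
    (-(2 : ℝ) / 3 * c - (-1 : ℝ) * 5 * s) ^ 2 + 45 * (-(2 : ℝ) / 3 * s + (-1 : ℝ) * (1/9 : ℝ) * c) ^ 2 = 1 := by
  subst hX; subst hP
  refine ⟨?_, ?_, by linear_combination h⟩
  · ext i; fin_cases i <;> simp [cross_apply]
    · linear_combination (2/15 : ℝ) * h
    · linear_combination (1/15 : ℝ) * h
    · linear_combination (1/6 : ℝ) * h
  · ext i; fin_cases i <;> simp [cross_apply]
    · linear_combination (4/15 : ℝ) * h
    · linear_combination (2/15 : ℝ) * h
    · linear_combination (1/3 : ℝ) * h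

/-- Ray b: on the circle every direction numerator has `X·(1,1,4) ≥ 3` (cosine `≥ 1/2` against the cap-centre vertical; in fact `≥ 0.738`). -/
theorem rayB_circle_bound (c s : ℝ) (h : c ^ 2 + 45 * s ^ 2 = 1) :
    (3 : ℝ) ≤ (![(4 : ℝ)/5, 2/5, 1] + c • ![(-16 : ℝ)/45, 7/45, 2/9] + s • ![(-1 : ℝ)/3, -8/3, 4/3]) ⬝ᵥ (![(1 : ℝ), 1, 4] : Fin 3 → ℝ) := by
  have e : (![(4 : ℝ)/5, 2/5, 1] + c • ![(-16 : ℝ)/45, 7/45, 2/9] + s • ![(-1 : ℝ)/3, -8/3, 4/3]) ⬝ᵥ (![(1 : ℝ), 1, 4] : Fin 3 → ℝ) = (26/5 : ℝ) + (31/45 : ℝ) * c + (7/3 : ℝ) * s := by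
    simp [dotProduct, Fin.sum_univ_three, Matrix.cons_val_zero, Matrix.cons_val_one, Matrix.cons_val_two, Matrix.head_cons,
      Matrix.tail_cons]; ring
  rw [e]
  have hA : (0 : ℝ) < 45 := by norm_num
  have := lin_pos_on_ellipse (l₀ := (26/5 : ℝ) - 3) (l₁ := (31/45 : ℝ)) (l₂ := (7/3 : ℝ)) hA h (by norm_num) (by norm_num)
  linarith

/-- Ray b: from level `1` on, the forced ray lies on the invariant circle. -/
theorem rayB_circle_levels (A : EuclideanSpace ℝ (Fin 3) ≃ₗᵢ[ℝ] EuclideanSpace ℝ (Fin 3))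
    {n z : EuclideanSpace ℝ (Fin 3)} {t : ℝ} (hn : ‖n‖ = 1)
    (hmenu : ∀ w ∈ fccSlots, ⟪A w, n⟫_ℝ = 0 ∨ ⟪A w, n⟫_ℝ = Real.sqrt (2 / 3) ∨ ⟪A w, n⟫_ℝ = -Real.sqrt (2 / 3))
    (hpos : ⟪A (slotSite 8), n⟫_ℝ = Real.sqrt (2 / 3))
    (hPn : cubicCoords (A.symm n) = (Real.sqrt 3)⁻¹ • (![(-1 : ℝ), 1, 1] : Fin 3 → ℝ))
    (hZ : cubicCoords (A.symm z) = t • (![(34 : ℝ), 32, 33] : Fin 3 → ℝ)) (ht : 0 < t) (m : ℕ) :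
    ∃ c s : ℝ, c ^ 2 + 45 * s ^ 2 = 1 ∧
      cubicCoords (A.symm ((forcedTop z ⟨A, slotSite 8, 0⟩ n (1 + m)).frame (forcedTop z ⟨A, slotSite 8, 0⟩ n (1 + m)).dir)) =
        (Real.sqrt 2)⁻¹ • (![(4 : ℝ)/5, 2/5, 1] + c • ![(-16 : ℝ)/45, 7/45, 2/9] + s • ![(-1 : ℝ)/3, -8/3, 4/3]) ∧
      cubicCoords (A.symm (nextNormal (forcedTop z ⟨A, slotSite 8, 0⟩ n (1 + m)))) =
        (Real.sqrt 3)⁻¹ • (![(4 : ℝ)/5, 2/5, 1] + c • ![(-11 : ℝ)/45, 47/45, -2/9] + s • ![(-17 : ℝ)/3, -1/3, 14/3]) := by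
  induction m with
  | zero =>
    obtain ⟨h1, h2⟩ := rayB_level1 A hn hmenu hpos hPn hZ ht
    refine ⟨1, 0, by norm_num, ?_, ?_⟩
    · rw [Nat.add_zero, h1]; congr 1; ext i; fin_cases i <;> norm_num [Matrix.cons_val_zero, Matrix.cons_val_one, Matrix.cons_val_two, Matrix.head_cons, Matrix.tail_cons]
    · rw [Nat.add_zero, h2]; congr 1; ext i; fin_cases i <;> norm_num [Matrix.cons_val_zero, Matrix.cons_val_one, Matrix.cons_val_two, Matrix.head_cons, Matrix.tail_cons]
  | succ m ih =>
    obtain ⟨c, s, h, hX, hP⟩ := ih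
    obtain ⟨hj, hlt⟩ := rayB_circle_selection c s h _ _ rfl rfl
    obtain ⟨u1, u2, u3⟩ := rayB_circle_update c s h _ _ rfl rfl
    obtain ⟨h1, h2⟩ := forcedTop_succ_cubic A hn hmenu hZ ht (1 + m) hX hP hj hlt
    refine ⟨(-(2 : ℝ) / 3 * c - (-1 : ℝ) * 5 * s), (-(2 : ℝ) / 3 * s + (-1 : ℝ) * (1/9 : ℝ) * c), u3, ?_, ?_⟩
    · rw [show 1 + (m + 1) = 1 + m + 1 by ring, h1, u1]
    · rw [show 1 + (m + 1) = 1 + m + 1 by ring, h2, u2]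

/-! ### Every level of either ray: cosine `≥ 1/2` against the cap-centre vertical -/

/-- **Every level of either forced ray of the terrace family has direction numerator `X` with `X·(1,1,4) ≥ 3`.** -/
theorem forcedTop_dir_cubic_terrace (A : EuclideanSpace ℝ (Fin 3) ≃ₗᵢ[ℝ] EuclideanSpace ℝ (Fin 3))
    {n z : EuclideanSpace ℝ (Fin 3)} {t : ℝ} (hn : ‖n‖ = 1)
    (hmenu : ∀ w ∈ fccSlots, ⟪A w, n⟫_ℝ = 0 ∨ ⟪A w, n⟫_ℝ = Real.sqrt (2 / 3) ∨ ⟪A w, n⟫_ℝ = -Real.sqrt (2 / 3))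
    (hpos : ⟪A (slotSite 8), n⟫_ℝ = Real.sqrt (2 / 3))
    (hZ : cubicCoords (A.symm z) = t • (![(34 : ℝ), 32, 33] : Fin 3 → ℝ)) (ht : 0 < t) (k : ℕ) :
    ∃ X : Fin 3 → ℝ,
      cubicCoords (A.symm ((forcedTop z ⟨A, slotSite 8, 0⟩ n k).frame (forcedTop z ⟨A, slotSite 8, 0⟩ n k).dir)) =
        (Real.sqrt 2)⁻¹ • X ∧ (3 : ℝ) ≤ X ⬝ᵥ (![(1 : ℝ), 1, 4] : Fin 3 → ℝ) := by
  rcases first_normal_cubic A hn hmenu hpos with hPn | hPn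
  · -- ray a: levels 0, 1 explicitly, then the circle
    rcases Nat.lt_or_ge k 2 with hk | hk
    · interval_cases k
      · exact ⟨_, (rayA_level0 A hn hmenu hpos hPn hZ ht).1, by
          norm_num [dotProduct, Fin.sum_univ_three, Matrix.cons_val_zero, Matrix.cons_val_one, Matrix.cons_val_two,
            Matrix.head_cons, Matrix.tail_cons]⟩
      · exact ⟨_, (rayA_level1 A hn hmenu hpos hPn hZ ht).1, by
          norm_num [dotProduct, Fin.sum_univ_three, Matrix.cons_val_zero, Matrix.cons_val_one, Matrix.cons_val_two,
            Matrix.head_cons, Matrix.tail_cons]⟩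
    · obtain ⟨m, rfl⟩ := Nat.exists_eq_add_of_le hk
      obtain ⟨c, s, h, hX, -⟩ := rayA_circle_levels A hn hmenu hpos hPn hZ ht m
      exact ⟨_, hX, rayA_circle_bound c s h⟩
  · -- ray b: level 0 explicitly, then the circle
    rcases Nat.lt_or_ge k 1 with hk | hk
    · interval_cases k
      exact ⟨_, (rayB_level0 A hn hmenu hpos hPn hZ ht).1, by
        norm_num [dotProduct, Fin.sum_univ_three, Matrix.cons_val_zero, Matrix.cons_val_one, Matrix.cons_val_two,
          Matrix.head_cons, Matrix.tail_cons]⟩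
    · obtain ⟨m, rfl⟩ := Nat.exists_eq_add_of_le hk
      obtain ⟨c, s, h, hX, -⟩ := rayB_circle_levels A hn hmenu hpos hPn hZ ht m
      exact ⟨_, hX, rayB_circle_bound c s h⟩

/-- **Forced-ray directions of the terrace family rise against the cap-centre vertical: `⟪d, A w₀⟫ ≥ 1/2`** for the
lattice unit vector `w₀` with cubic coordinates `(1,1,4)/(3√2)`. -/
theorem forcedTop_dir_inner_terrace (A : EuclideanSpace ℝ (Fin 3) ≃ₗᵢ[ℝ] EuclideanSpace ℝ (Fin 3))
    {n z w₀ : EuclideanSpace ℝ (Fin 3)} {t : ℝ} (hn : ‖n‖ = 1)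
    (hmenu : ∀ w ∈ fccSlots, ⟪A w, n⟫_ℝ = 0 ∨ ⟪A w, n⟫_ℝ = Real.sqrt (2 / 3) ∨ ⟪A w, n⟫_ℝ = -Real.sqrt (2 / 3))
    (hpos : ⟪A (slotSite 8), n⟫_ℝ = Real.sqrt (2 / 3))
    (hZ : cubicCoords (A.symm z) = t • (![(34 : ℝ), 32, 33] : Fin 3 → ℝ)) (ht : 0 < t)
    (hw₀ : cubicCoords w₀ = (3 * Real.sqrt 2)⁻¹ • (![(1 : ℝ), 1, 4] : Fin 3 → ℝ)) (k : ℕ) :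
    (1 / 2 : ℝ) ≤ ⟪(forcedTop z ⟨A, slotSite 8, 0⟩ n k).frame (forcedTop z ⟨A, slotSite 8, 0⟩ n k).dir, A w₀⟫_ℝ := by
  obtain ⟨hs2, -, hs2p, -, -⟩ := sqrt_two_three_facts
  obtain ⟨X, hX, hb⟩ := forcedTop_dir_cubic_terrace A hn hmenu hpos hZ ht k
  rw [inner_eq_cubic_symm A, A.symm_apply_apply, hX, hw₀, smul_dotProduct, dotProduct_smul, smul_eq_mul, smul_eq_mul]
  have e : (Real.sqrt 2)⁻¹ * ((3 * Real.sqrt 2)⁻¹ * (X ⬝ᵥ (![(1 : ℝ), 1, 4] : Fin 3 → ℝ))) =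
      (X ⬝ᵥ (![(1 : ℝ), 1, 4] : Fin 3 → ℝ)) / 6 := by
    field_simp; nlinarith [hs2]
  rw [e]; linarith

/-- The start slot itself: `⟪A u, A w₀⟫ = 5/6`. -/
theorem start_slot_inner_terrace (A : EuclideanSpace ℝ (Fin 3) ≃ₗᵢ[ℝ] EuclideanSpace ℝ (Fin 3)) {w₀ : EuclideanSpace ℝ (Fin 3)}
    (hw₀ : cubicCoords w₀ = (3 * Real.sqrt 2)⁻¹ • (![(1 : ℝ), 1, 4] : Fin 3 → ℝ)) :
    ⟪A (slotSite 8), A w₀⟫_ℝ = 5 / 6 := by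
  obtain ⟨hs2, -, hs2p, -, -⟩ := sqrt_two_three_facts
  rw [LinearIsometryEquiv.inner_map_map, inner_eq_cubicCoords, cubicCoords_slotSite_eight, hw₀, smul_dotProduct,
    dotProduct_smul, smul_eq_mul, smul_eq_mul]
  norm_num [dotProduct, Fin.sum_univ_three, Matrix.cons_val_zero, Matrix.cons_val_one, Matrix.cons_val_two,
    Matrix.head_cons, Matrix.tail_cons]
  field_simp; nlinarith [hs2]

/-! ### The stack form consumed by the W1-conditional one-sided ledger -/

/-- **`hdirs` for the terrace-steered steep family (cap-centre form).**  For EVERY sound well-formed `z`-stack over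
the bottom `⟨A, slotSite 8, 0⟩`, `z` the steering with `cubicCoords (A.symm z) ∥ (34,32,33)`, every entry's direction
has `⟪F v, A w₀⟫ ≥ 1/2` (`w₀` the lattice unit vector with cubic coordinates `(1,1,4)/(3√2)` — the inward vertical
at the exact `Σ3`/`Σ9` cap centre). -/
theorem stack_dirs_terrace (A : EuclideanSpace ℝ (Fin 3) ≃ₗᵢ[ℝ] EuclideanSpace ℝ (Fin 3))
    {z w₀ : EuclideanSpace ℝ (Fin 3)} {t : ℝ}
    (hZ : cubicCoords (A.symm z) = t • (![(34 : ℝ), 32, 33] : Fin 3 → ℝ)) (ht : 0 < t)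
    (hw₀ : cubicCoords w₀ = (3 * Real.sqrt 2)⁻¹ • (![(1 : ℝ), 1, 4] : Fin 3 → ℝ)) :
    ∀ stk : List WalkEntry, StackSound z stk → StackWF z stk → stk.getLast? = some ⟨A, slotSite 8, 0⟩ →
      ∀ e ∈ stk, (1 / 2 : ℝ) ≤ ⟪e.frame e.dir, A w₀⟫_ℝ := by
  intro stk hS hW hlast e he
  cases stk with
  | nil => exact absurd hS (stackSound_nil z)
  | cons e₁ rest =>
    rcases entries_forced rest e₁ hS hW hlast e he with h | ⟨n, hn, hmenu, hpos, k, hk⟩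
    · rw [h, start_slot_inner_terrace A hw₀]; norm_num
    · rw [hk]; exact forcedTop_dir_inner_terrace A hn hmenu hpos hZ ht hw₀ k

/-- Directions on such stacks are unit vectors. -/
theorem stack_dir_norm_terrace (A : EuclideanSpace ℝ (Fin 3) ≃ₗᵢ[ℝ] EuclideanSpace ℝ (Fin 3)) {z : EuclideanSpace ℝ (Fin 3)} :
    ∀ stk : List WalkEntry, StackSound z stk → StackWF z stk → stk.getLast? = some ⟨A, slotSite 8, 0⟩ →
      ∀ e ∈ stk, ‖e.frame e.dir‖ = 1 := by
  intro stk hS hW hlast e he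
  cases stk with
  | nil => exact absurd hS (stackSound_nil z)
  | cons e₁ rest =>
    rcases entries_forced rest e₁ hS hW hlast e he with h | ⟨n, hn, hmenu, -, k, hk⟩
    · rw [h, LinearIsometryEquiv.norm_map]; exact norm_eq_one_of_mem_fccSlots (slotSite_mem 8)
    · obtain ⟨hν, hmenuk, -⟩ := forcedTop_chain_invariant z A (slotSite 8) hn hmenu k
      obtain ⟨hd, -⟩ := forcedTop_dir_mem_pos (z := z) (b := ⟨A, slotSite 8, 0⟩) (n := n) (k := k) hν hmenuk
      rw [hk, LinearIsometryEquiv.norm_map]; exact norm_eq_one_of_mem_fccSlots hd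

/-- **`hdirs` for ANY inward vertical `w` (the W1 hypothesis, orientation-dependent constant).**  With
`δ = 1/2 − ‖A.symm w − w₀‖`: every direction on every sound well-formed `z`-stack over `⟨A, slotSite 8, 0⟩` has
`⟪F v, w⟫ ≥ δ`; `δ > 0` whenever the pulled-back vertical is within chord distance `1/2` (`≈ 29°`) of the cap centre. -/
theorem stack_dirs_terrace_of_near (A : EuclideanSpace ℝ (Fin 3) ≃ₗᵢ[ℝ] EuclideanSpace ℝ (Fin 3))
    {z w₀ : EuclideanSpace ℝ (Fin 3)} {t : ℝ}
    (hZ : cubicCoords (A.symm z) = t • (![(34 : ℝ), 32, 33] : Fin 3 → ℝ)) (ht : 0 < t)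
    (hw₀ : cubicCoords w₀ = (3 * Real.sqrt 2)⁻¹ • (![(1 : ℝ), 1, 4] : Fin 3 → ℝ)) (w : EuclideanSpace ℝ (Fin 3)) :
    ∀ stk : List WalkEntry, StackSound z stk → StackWF z stk → stk.getLast? = some ⟨A, slotSite 8, 0⟩ →
      ∀ e ∈ stk, 1 / 2 - ‖A.symm w - w₀‖ ≤ ⟪e.frame e.dir, w⟫_ℝ := by
  intro stk hS hW hlast e he
  have h1 := stack_dirs_terrace A hZ ht hw₀ stk hS hW hlast e he
  have hd := stack_dir_norm_terrace A stk hS hW hlast e he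
  have hsplit : ⟪e.frame e.dir, w⟫_ℝ = ⟪e.frame e.dir, A w₀⟫_ℝ + ⟪e.frame e.dir, w - A w₀⟫_ℝ := by
    rw [← inner_add_right, add_sub_cancel]
  have hCS : |⟪e.frame e.dir, w - A w₀⟫_ℝ| ≤ ‖e.frame e.dir‖ * ‖w - A w₀‖ := abs_real_inner_le_norm _ _
  have hnorm : ‖w - A w₀‖ = ‖A.symm w - w₀‖ := by
    rw [← A.symm.norm_map (w - A w₀), map_sub, A.symm_apply_apply]
  rw [hd, one_mul, hnorm] at hCS
  have := neg_le_of_abs_le hCS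
  linarith

/-! ### The family's data: the steering and the cap-centre vertical exist, and the start slot is steep -/

/-- The vector with prescribed cubic coordinates. -/
theorem exists_of_cubicCoords (c : Fin 3 → ℝ) : ∃ x : EuclideanSpace ℝ (Fin 3), cubicCoords x = c := by
  refine ⟨c 0 • cubicFrame 0 + c 1 • cubicFrame 1 + c 2 • cubicFrame 2, ?_⟩
  rw [cubicCoords_add, cubicCoords_add, cubicCoords_smul, cubicCoords_smul, cubicCoords_smul, cubicCoords_cubicFrame,
    cubicCoords_cubicFrame, cubicCoords_cubicFrame]
  ext i; fin_cases i <;> simp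

/-- **The terrace steering exists**: a UNIT lattice vector `zs` with `cubicCoords zs = (34,32,33)/√3269`, for which the
start slot `slotSite 8` is steep (`⟪A u, A zs⟫ ≥ √2/2`) and `cubicCoords (A.symm (A zs)) = (√3269)⁻¹ • (34,32,33)`. -/
theorem exists_terrace_steering :
    ∃ zs : EuclideanSpace ℝ (Fin 3), ‖zs‖ = 1 ∧ cubicCoords zs = (Real.sqrt 3269)⁻¹ • (![(34 : ℝ), 32, 33] : Fin 3 → ℝ) ∧
      0 < (Real.sqrt 3269)⁻¹ ∧
      ∀ A : EuclideanSpace ℝ (Fin 3) ≃ₗᵢ[ℝ] EuclideanSpace ℝ (Fin 3),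
        cubicCoords (A.symm (A zs)) = (Real.sqrt 3269)⁻¹ • (![(34 : ℝ), 32, 33] : Fin 3 → ℝ) ∧
        Real.sqrt 2 / 2 ≤ ⟪A (slotSite 8), A zs⟫_ℝ := by
  obtain ⟨zs, hzs⟩ := exists_of_cubicCoords ((Real.sqrt 3269)⁻¹ • (![(34 : ℝ), 32, 33] : Fin 3 → ℝ))
  obtain ⟨hs2, -, hs2p, -, -⟩ := sqrt_two_three_facts
  have hN : Real.sqrt 3269 * Real.sqrt 3269 = 3269 := Real.mul_self_sqrt (by norm_num)
  have hNp : 0 < Real.sqrt 3269 := Real.sqrt_pos.2 (by norm_num)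
  have hnorm : ‖zs‖ = 1 := by
    have h : ‖zs‖ ^ 2 = 1 := by
      rw [norm_sq_eq_cubicCoords, hzs, smul_dotProduct, dotProduct_smul, smul_eq_mul, smul_eq_mul]
      norm_num [dotProduct, Fin.sum_univ_three, Matrix.cons_val_zero, Matrix.cons_val_one, Matrix.cons_val_two,
        Matrix.head_cons, Matrix.tail_cons]
      field_simp; linarith [hN]
    nlinarith [norm_nonneg zs, h]
  refine ⟨zs, hnorm, hzs, inv_pos.2 hNp, fun A => ⟨by rw [A.symm_apply_apply, hzs], ?_⟩⟩
  rw [LinearIsometryEquiv.inner_map_map, inner_eq_cubicCoords, cubicCoords_slotSite_eight, hzs, smul_dotProduct,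
    dotProduct_smul, smul_eq_mul, smul_eq_mul]
  norm_num [dotProduct, Fin.sum_univ_three, Matrix.cons_val_zero, Matrix.cons_val_one, Matrix.cons_val_two,
    Matrix.head_cons, Matrix.tail_cons]
  -- `√2/2 ≤ (√2)⁻¹ (√3269)⁻¹ 65`  ⟸  `3269 ≤ 65²`
  rw [div_le_iff₀ (by norm_num : (0:ℝ) < 2)]
  have h65 : Real.sqrt 3269 ≤ 65 := by nlinarith [hN, hNp]
  have key : (Real.sqrt 2)⁻¹ * ((Real.sqrt 3269)⁻¹ * 65) * 2 = Real.sqrt 2 * (65 / Real.sqrt 3269) := by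
    field_simp; nlinarith [hs2]
  rw [key]
  have h1 : 1 ≤ 65 / Real.sqrt 3269 := by rw [le_div_iff₀ hNp]; linarith
  nlinarith [h1, hs2p]

/-- **The cap-centre vertical exists**: a unit lattice vector `w₀` with `cubicCoords w₀ = (1,1,4)/(3√2)`. -/
theorem exists_cap_centre_vertical :
    ∃ w₀ : EuclideanSpace ℝ (Fin 3), ‖w₀‖ = 1 ∧ cubicCoords w₀ = (3 * Real.sqrt 2)⁻¹ • (![(1 : ℝ), 1, 4] : Fin 3 → ℝ) := by
  obtain ⟨w₀, hw₀⟩ := exists_of_cubicCoords ((3 * Real.sqrt 2)⁻¹ • (![(1 : ℝ), 1, 4] : Fin 3 → ℝ))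
  obtain ⟨hs2, -, hs2p, -, -⟩ := sqrt_two_three_facts
  refine ⟨w₀, ?_, hw₀⟩
  have h : ‖w₀‖ ^ 2 = 1 := by
    rw [norm_sq_eq_cubicCoords, hw₀, smul_dotProduct, dotProduct_smul, smul_eq_mul, smul_eq_mul]
    norm_num [dotProduct, Fin.sum_univ_three, Matrix.cons_val_zero, Matrix.cons_val_one, Matrix.cons_val_two,
      Matrix.head_cons, Matrix.tail_cons]
    field_simp; nlinarith [hs2]
  nlinarith [norm_nonneg w₀, h]


end Summit.Ventures.Crystal3D.Theorems

end
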